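import Literature.AlgebraicGeometry.Resolution.Blowups
import Literature.AlgebraicGeometry.Resolution.IdealSheafLemmas
import HarnessLib

/-!
# Blowing ups and effective Cartier divisors: locality and transport along isomorphisms

Topic: `Literature/AlgebraicGeometry/Resolution`. Complements to `Blowups.lean` (the landed
merge p9615 of `IsEffectiveCartier` / `IsBlowup`, Görtz–Wedhorn Def. 13.90, with
`IsEffectiveCartier.comap_ι`, `IsBlowup.restrict`, `IsBlowup.isIso_compl` = Stacks 02OS proved),
all PROVED from the definitions:

* `IsEffectiveCartier.comap_of_isOpenImmersion` — effective Cartier ideal sheaves pull back along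
  arbitrary open immersions (`comap_ι` of `Blowups.lean` is the case of `U.ι`; here via the
  localization `Γ(X, D(g))` of the generator instead of flatness);
* `exists_generator_image_of_isOpenImmersion`, `isEffectiveCartier_of_openCover` — **being
  effective Cartier is local on `X`**: if the pull-backs along the members of an open cover are
  effective Cartier, so is the ideal sheaf (the effective-Cartier half of "being a blowing up is
  local on the base");
* `IsEffectiveCartier.comap_iso`, `IsBlowup.iso_comp`, `IsBlowup.comp_iso` — transport of
  blowing ups along isomorphisms of source and target.

## Sources

* The Stacks Project, Tag 01WS (Lemma 31.14.2), Tag 0806 (Lemma 31.33.5). [StacksProject]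
* U. Görtz, T. Wedhorn, *Algebraic Geometry I*, 2nd ed., Def. 13.90. [GortzWedhorn2020]
-/

noncomputable section

open CategoryTheory CategoryTheory.Limits AlgebraicGeometry TopologicalSpace Opposite

namespace Literature.AlgebraicGeometry.Resolution

universe u

/-! ## Effective Cartier ideal sheaves restrict to opens -/

/-- **Effective Cartier ideal sheaves restrict to open subschemes**: if `K` is effective
Cartier on `X` and `i : V → X` is an open immersion then `K.comap i` (= `K|_V`) is effective
Cartier. [cite: StacksProject, Tag 01WS] -/
theorem IsEffectiveCartier.comap_of_isOpenImmersion
    {V X : Scheme.{u}} {K : X.IdealSheafData} (hK : IsEffectiveCartier K) (i : V ⟶ X)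
    [IsOpenImmersion i] : IsEffectiveCartier (K.comap i) := by
  intro v
  obtain ⟨U₀, hxU₀, f, hf, hfK⟩ := hK (i v)
  -- a basic open of `U₀` around `i v` inside the image of `i`
  obtain ⟨g, hg_le, hxg⟩ := U₀.2.exists_basicOpen_le (V := i.opensRange) ⟨i v, ⟨v, rfl⟩⟩ hxU₀
  have hU₁ : IsAffineOpen (X.basicOpen g) := U₀.2.basicOpen g
  have hle₀ : X.basicOpen g ≤ U₀ := X.basicOpen_le g
  -- the affine open `W := i⁻¹(D(g))` of `V`
  have hW : IsAffineOpen (i ⁻¹ᵁ X.basicOpen g) := hU₁.preimage_of_isOpenImmersion i hg_le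
  let W : V.affineOpens := ⟨i ⁻¹ᵁ X.basicOpen g, hW⟩
  have e₁ : i ''ᵁ (i ⁻¹ᵁ X.basicOpen g) = X.basicOpen g := by
    rw [Scheme.Hom.image_preimage_eq_opensRange_inf, inf_eq_right.mpr hg_le]
  -- the generator on `D(g)`: the restriction of `f`, a nonzerodivisor of the localization
  let f₁ : Γ(X, X.basicOpen g) := (X.presheaf.map (homOfLE hle₀).op).hom f
  have hK₁ : K.ideal ⟨X.basicOpen g, hU₁⟩ = Ideal.span {f₁} := by
    rw [← K.map_ideal (U := ⟨X.basicOpen g, hU₁⟩) (V := U₀) hle₀, hfK, Ideal.map_span,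
      Set.image_singleton]
    rfl
  have hf₁ : f₁ ∈ nonZeroDivisors Γ(X, X.basicOpen g) := by
    haveI := U₀.2.isLocalization_basicOpen g
    exact IsLocalization.nonZeroDivisors_le_comap (M := .powers g) (S := Γ(X, X.basicOpen g)) hf
  -- transport to the (equal) open `i '' W`
  let ρ : Γ(X, X.basicOpen g) ⟶ Γ(X, i ''ᵁ (i ⁻¹ᵁ X.basicOpen g)) :=
    X.presheaf.map (homOfLE e₁.le).op
  let ρ' : Γ(X, i ''ᵁ (i ⁻¹ᵁ X.basicOpen g)) ⟶ Γ(X, X.basicOpen g) :=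
    X.presheaf.map (homOfLE e₁.ge).op
  have hρρ' : ∀ a, ρ'.hom (ρ.hom a) = a := fun a => by
    change (ρ ≫ ρ').hom a = a
    rw [show ρ ≫ ρ' = 𝟙 _ by
      rw [← X.presheaf.map_comp, show (homOfLE e₁.le).op ≫ (homOfLE e₁.ge).op = 𝟙 _ from
        Subsingleton.elim _ _, X.presheaf.map_id]]
    rfl
  have hρ'ρ : ∀ b, ρ.hom (ρ'.hom b) = b := fun b => by
    change (ρ' ≫ ρ).hom b = b
    rw [show ρ' ≫ ρ = 𝟙 _ by
      rw [← X.presheaf.map_comp, show (homOfLE e₁.ge).op ≫ (homOfLE e₁.le).op = 𝟙 _ from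
        Subsingleton.elim _ _, X.presheaf.map_id]]
    rfl
  let f₂ : Γ(X, i ''ᵁ (i ⁻¹ᵁ X.basicOpen g)) := ρ.hom f₁
  have hf₂ : f₂ ∈ nonZeroDivisors _ := mem_nonZeroDivisors_of_inverse ρ.hom ρ'.hom hρρ' hρ'ρ hf₁
  have hK₂ : K.ideal ⟨i ''ᵁ (i ⁻¹ᵁ X.basicOpen g), W.2.image_of_isOpenImmersion i⟩ =
      Ideal.span {f₂} := by
    rw [← K.map_ideal (U := ⟨i ''ᵁ (i ⁻¹ᵁ X.basicOpen g), W.2.image_of_isOpenImmersion i⟩)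
      (V := ⟨X.basicOpen g, hU₁⟩) e₁.le, hK₁, Ideal.map_span, Set.image_singleton]
    rfl
  -- and through the isomorphism `Γ(X, i '' W) ≅ Γ(V, W)`
  let e : Γ(X, i ''ᵁ (i ⁻¹ᵁ X.basicOpen g)) ≃+* Γ(V, i ⁻¹ᵁ X.basicOpen g) :=
    (i.appIso (i ⁻¹ᵁ X.basicOpen g)).commRingCatIsoToRingEquiv
  refine ⟨W, hxg, e f₂, ?_, ?_⟩
  · exact mem_nonZeroDivisors_of_inverse e.toRingHom e.symm.toRingHom (fun a => e.symm_apply_apply a)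
      (fun b => e.apply_symm_apply b) hf₂
  · rw [Scheme.IdealSheafData.ideal_comap_of_isOpenImmersion, hK₂]
    change (Ideal.span {f₂}).comap e.symm.toRingHom = _
    rw [show (Ideal.span {f₂}).comap e.symm.toRingHom = (Ideal.span {f₂}).comap e.symm from rfl,
      Ideal.comap_symm, Ideal.map_span, Set.image_singleton]

/-! ## Locality of effective Cartier ideal sheaves; transport of blowing ups along isomorphisms -/

/-- Pushing a principal generator through an open immersion: if `i : V → X` is an open immersion,
`W ⊆ V` an affine open and `(K.comap i)(W)` is generated by a nonzerodivisor, then so is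
`K(i(W))`. [folklore] -/
theorem exists_generator_image_of_isOpenImmersion {V X : Scheme.{u}} (K : X.IdealSheafData)
    (i : V ⟶ X) [IsOpenImmersion i] (W : V.affineOpens) (g : Γ(V, W))
    (hg : g ∈ nonZeroDivisors Γ(V, W)) (hK : (K.comap i).ideal W = Ideal.span {g}) :
    ∃ g' : Γ(X, i ''ᵁ W), g' ∈ nonZeroDivisors Γ(X, i ''ᵁ W) ∧
      K.ideal ⟨i ''ᵁ W, W.2.image_of_isOpenImmersion i⟩ = Ideal.span {g'} := by
  let e : Γ(X, i ''ᵁ (W : V.Opens)) ≃+* Γ(V, W) := (i.appIso W).commRingCatIsoToRingEquiv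
  have h3 : (K.ideal ⟨i ''ᵁ W, W.2.image_of_isOpenImmersion i⟩).comap e.symm.toRingHom =
      Ideal.span {g} := by
    rw [← hK]
    exact (Scheme.IdealSheafData.ideal_comap_of_isOpenImmersion K i W).symm
  refine ⟨e.symm g, ?_, ?_⟩
  · exact mem_nonZeroDivisors_of_inverse e.symm.toRingHom e.toRingHom
      (fun a => e.apply_symm_apply a) (fun a => e.symm_apply_apply a) hg
  · have : K.ideal ⟨i ''ᵁ W, W.2.image_of_isOpenImmersion i⟩ =
        ((K.ideal ⟨i ''ᵁ W, W.2.image_of_isOpenImmersion i⟩).comap e.symm.toRingHom).comap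
          e.toRingHom := by
      rw [Ideal.comap_comap]
      convert (Ideal.comap_id _).symm
      ext a
      exact e.symm_apply_apply a
    rw [this, h3]
    exact comap_span_singleton_ringEquiv e g

/-- **Being effective Cartier is local**: if the pull-backs of `K` along the members of an open
cover are effective Cartier, so is `K`. [cite: StacksProject, Tag 01WS] -/
theorem isEffectiveCartier_of_openCover {X : Scheme.{u}} (K : X.IdealSheafData)
    (𝒱 : X.OpenCover) (h : ∀ i, IsEffectiveCartier (K.comap (𝒱.f i))) :
    IsEffectiveCartier K := by
  intro x
  obtain ⟨y, hy⟩ := 𝒱.covers x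
  obtain ⟨W, hyW, g, hg, hK⟩ := h (𝒱.idx x) y
  obtain ⟨g', hg', hK'⟩ := exists_generator_image_of_isOpenImmersion K (𝒱.f (𝒱.idx x)) W g hg hK
  exact ⟨⟨𝒱.f (𝒱.idx x) ''ᵁ W, W.2.image_of_isOpenImmersion _⟩, ⟨y, hyW, hy⟩, g', hg', hK'⟩

/-- Effective Cartier ideal sheaves pull back along isomorphisms. [folklore] -/
theorem IsEffectiveCartier.comap_iso {V X : Scheme.{u}} {K : X.IdealSheafData}
    (hK : IsEffectiveCartier K) (e : V ≅ X) : IsEffectiveCartier (K.comap e.hom) :=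
  hK.comap_of_isOpenImmersion e.hom

/-- **Blowing ups transport along isomorphisms of the source.** [folklore] -/
theorem IsBlowup.iso_comp {X'' X' X : Scheme.{u}} {π : X' ⟶ X} {J : X.IdealSheafData}
    (h : IsBlowup π J) (e : X'' ≅ X') : IsBlowup (e.hom ≫ π) J where
  isEffectiveCartier := by
    rw [Scheme.IdealSheafData.comap_comp]
    exact h.isEffectiveCartier.comap_iso e
  universal := by
    intro W f hf
    refine ⟨h.lift f hf ≫ e.inv, ?_, ?_⟩
    · change (h.lift f hf ≫ e.inv) ≫ e.hom ≫ π = f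
      rw [Category.assoc, e.inv_hom_id_assoc, h.lift_comp]
    · intro g hg
      change g ≫ e.hom ≫ π = f at hg
      rw [← Category.assoc] at hg
      rw [← h.lift_unique f hf hg, Category.assoc, e.hom_inv_id, Category.comp_id]

/-- **Blowing ups transport along isomorphisms of the target** (with the ideal sheaf moved
along). [folklore] -/
theorem IsBlowup.comp_iso {X' X Y : Scheme.{u}} {π : X' ⟶ X} {J : X.IdealSheafData}
    (h : IsBlowup π J) (e : X ≅ Y) : IsBlowup (π ≫ e.hom) (J.comap e.inv) where
  isEffectiveCartier := by
    rw [← Scheme.IdealSheafData.comap_comp, Category.assoc, e.hom_inv_id, Category.comp_id]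
    exact h.isEffectiveCartier
  universal := by
    intro W f hf
    rw [← Scheme.IdealSheafData.comap_comp] at hf
    obtain ⟨g, hg, hgu⟩ := h.universal (f ≫ e.inv) hf
    refine ⟨g, ?_, fun g' hg' => hgu g' ?_⟩
    · change g ≫ π ≫ e.hom = f
      rw [← Category.assoc, hg, Category.assoc, e.inv_hom_id, Category.comp_id]
    · change g' ≫ π ≫ e.hom = f at hg'
      rw [← hg', Category.assoc, Category.assoc, e.hom_inv_id, Category.comp_id]

end Literature.AlgebraicGeometry.Resolution

end
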